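import Literature.NumberTheory.GaloisCohomology.SelmerStructureModifyOnePlaceProofs
import HarnessLib

/-!
# Howard 2004, Prop. 1.5.9 («`loc_ℓ(Stub(n)) = 0 ⟹ loc_ℓ(Stub(nℓ)) = 0`»): the Galois-side assembly
# from the `loc_ℓ` identifications, the structure decompositions and the Lagrangian transfer (proofs file)

Topic `NumberTheory/GaloisCohomology/Howard2004` (sequel to `GaloisCohomology/SelmerStructureModifyOnePlaceProofs`
and `GaloisRepresentations/SelmerStructureOnePlaceComparisonProofs`).  THEOREMS ONLY: no definition, no named
fact, no instance, no `sorry`.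

B. Howard, *The Heegner point Kolyvagin system*, Compositio Math. 140 (2004), Prop. 1.5.9 (= arXiv:1202.6340
Prop. 2.5.9, p. 10 L146 – p. 11 L13): «For `nℓ ∈ 𝓝`, `loc_ℓ(Stub(n)) = 0 ⟹ loc_ℓ(Stub(ℓn)) = 0`.  Proof.
… `loc_ℓ(Stub(n)) = 0` implies that `𝔪^{λ(n)}` kills the lower left quotient, and so `a, b ≤ λ(n)`.  The diagram
immediately implies `λ(nℓ) = λ(n) + k − a − b − δ ≥ k − a − δ, k − b − δ` so that `𝔪^{λ(nℓ)}` kills the lower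
right quotient.»  Here `Stub(m) = 𝔪^{λ(m)} 𝓗(m)` with `𝓗(m) ≅ R^ε ⊕ M(m) ⊕ M(m)`, `λ(m) = len M(m)`
(Def. 1.5.4), `ε` independent of `m` (Prop. 1.5.5).

WHAT THIS FILE DOES (the Galois-side half; the module-theoretic half — Lemma 1.5.7's pairing, Lemma 1.5.8's
diagram and the exponent transfer — is `Literature/Algebra/Module/LagrangianSubmodulesSplitPairing`, consumed
here as the HYPOTHESIS-FUNCTION `htransfer`, so that this file does not depend on its final shape):
* §1 `two_mul_add_eq_two_mul_add_of_lengths` — the ℕ∞ bookkeeping: from `len 𝓗(n) = len 𝓗_ℓ(n) + len A_f`,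
  `len 𝓗(nℓ) = len 𝓗_ℓ(n) + len A_tr` (the `loc_ℓ` identifications) and `len 𝓗(m) = ε·k + 2·λ(m)` one gets the
  length hypothesis of the transfer, **`2·λ(nℓ) + len A_f = 2·λ(n) + len A_tr`**;
* §2 `length_eq_of_linearEquiv_pi_prod_prod` — `len H = ε·k + 2·len M` for `H ≃ₗ[R] (Fin ε → Q) × (M × M)`,
  `len Q = k`;
* §3 **`two_mul_add_length_eq_of_decompositions`** — §1 + §2 in the Selmer-structure setting of Howard's
  `F^q(n) ⊇ F(n), F(nq) ⊇ F_q(n)` (`SelmerStructure.modify`), for the functorial `R`-module structures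
  (`moduleH1`) and `R`-submodules with the Selmer groups as underlying groups;
* §4 **`smul_le_ker_of_smul_le_ker_of_transfer`** — PROP. 1.5.9 in the consumer's currency:
  `ϖ^{λ(n)} • 𝓗(n) ≤ ker loc_q → ϖ^{λ(nq)} • 𝓗(nq) ≤ ker loc_q`, given the decompositions and the transfer
  function at `q` (= the input `h159` of the induction skeleton of Lemma 1.6.4,
  `Howard2004/StubLemmaInductionProofs`).
Not here (inputs, by name or as hypotheses): the local splitting `H¹(K_q, T) = H¹_f ⊕ H¹_tr` (Prop. 1.1.9),
`A = A^⟂` (Lemma 1.5.6), the structure theorem (Thm. 1.4.2), the transfer itself (Lagrangian algebra).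

Cell `pub/bsd-print-x9`, G87 = Howard 2004 Thm. 1.6.1 (`Howard2004.thm161_dvrKolyvaginBound`, print leaf of
stmt-BirchSwinnertonDyer-22642); seat `bsd-line-x9-p1-w3` g14, brick (H159-ASM).  BSD is not proved by any of this.
-/

set_option autoImplicit false

noncomputable section

open NumberField

universe u v

namespace Literature.NumberTheory.GaloisCohomology.Howard2004

open Literature.NumberTheory.GaloisRepresentations
open Literature.NumberTheory.GaloisRepresentations.DiscreteGaloisModule

/-! ## §1 The ℕ∞ bookkeeping -/

/-- From `l₁ = lS + lf`, `l₂ = lS + ltr`, `l₁ = ε·k + 2·m₁`, `l₂ = ε·k + 2·m₂` with `l₁, l₂` finite: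
`2·m₂ + lf = 2·m₁ + ltr` (in `ℕ∞`).
[cite: Howard2004HeegnerKolyvagin, Prop. 1.5.9 (proof) (arXiv:1202.6340 Prop. 2.5.9, p. 11 L3–9)] -/
theorem two_mul_add_eq_two_mul_add_of_lengths {l₁ l₂ lS lf ltr m₁ m₂ c : ℕ∞}
    (h₁ : l₁ = lS + lf) (h₂ : l₂ = lS + ltr) (hd₁ : l₁ = c + 2 * m₁) (hd₂ : l₂ = c + 2 * m₂)
    (hfin₁ : l₁ ≠ ⊤) (hfin₂ : l₂ ≠ ⊤) : 2 * m₂ + lf = 2 * m₁ + ltr := by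
  -- everything is finite
  have hS : lS ≠ ⊤ := fun h => hfin₁ (by rw [h₁, h, top_add])
  have hf : lf ≠ ⊤ := fun h => hfin₁ (by rw [h₁, h, add_top])
  have htr : ltr ≠ ⊤ := fun h => hfin₂ (by rw [h₂, h, add_top])
  have hc : c ≠ ⊤ := fun h => hfin₁ (by rw [hd₁, h, top_add])
  have hm₁ : m₁ ≠ ⊤ := fun h => hfin₁ (by rw [hd₁, h]; simp)
  have hm₂ : m₂ ≠ ⊤ := fun h => hfin₂ (by rw [hd₂, h]; simp)
  lift lS to ℕ using hS
  lift lf to ℕ using hf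
  lift ltr to ℕ using htr
  lift c to ℕ using hc
  lift m₁ to ℕ using hm₁
  lift m₂ to ℕ using hm₂
  have e₁ : ((lS + lf : ℕ) : ℕ∞) = ((c + 2 * m₁ : ℕ) : ℕ∞) := by
    push_cast; rw [← h₁, ← hd₁]
  have e₂ : ((lS + ltr : ℕ) : ℕ∞) = ((c + 2 * m₂ : ℕ) : ℕ∞) := by
    push_cast; rw [← h₂, ← hd₂]
  have e₁' := ENat.coe_inj.1 e₁
  have e₂' := ENat.coe_inj.1 e₂
  have : ((2 * m₂ + lf : ℕ) : ℕ∞) = ((2 * m₁ + ltr : ℕ) : ℕ∞) := by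
    congr 1; omega
  exact_mod_cast this

/-! ## §2 The length of a structure decomposition `H ≅ Q^ε ⊕ M ⊕ M` -/

/-- `len_R H = ε·len Q + 2·len M` for `H ≃ₗ[R] (Fin ε → Q) × (M × M)`
(Howard: `𝓗(n) ≅ R^ε ⊕ M(n) ⊕ M(n)`, `len R^{(k)} = k`, `λ(n) = len M(n)`).
[cite: Howard2004HeegnerKolyvagin, Def. 1.5.4 and display (structure decomposition) (arXiv:1202.6340 p. 10 L46–60)] -/
theorem length_eq_of_linearEquiv_pi_prod_prod {R : Type*} [Ring R] {H Q M : Type*} [AddCommGroup H]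
    [Module R H] [AddCommGroup Q] [Module R Q] [AddCommGroup M] [Module R M] (ε : ℕ)
    (θ : H ≃ₗ[R] (Fin ε → Q) × (M × M)) :
    Module.length R H = ε * Module.length R Q + 2 * Module.length R M := by
  rw [θ.length_eq, Module.length_prod, Module.length_pi, Module.length_prod, two_mul]
  simp

/-! ## §3 The length hypothesis of the transfer, in the Selmer-structure setting -/

section Selmer

variable {K : Type u} [Field K] [NumberField K] {M : Type u} [AddCommGroup M]
  [TopologicalSpace M] [DiscreteTopology M] {ρ : DiscreteGaloisModule K M}
  {R : Type v} [CommRing R] [Module R M]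

open scoped Classical in
/-- **`2·λ(nq) + len A_f = 2·λ(n) + len A_tr`.**  Setting: `𝓕`, `𝒯` Selmer structures, `q ∉ n`; the
functorial `R`-module structures on `H¹(K, M)`, `H¹(K_q, M)`; `R`-submodules `S₁, S₂, S𝓢` of `H¹(K, M)` with
underlying groups `𝓗(n), 𝓗(nq), 𝓗_q(n)` (the Selmer groups of `𝓕.modify 𝒯 ∅ ∅ n`, `… (insert q n)`,
`𝓕.modify 𝒯 ∅ {q} n`) and `SA, SVf, SVtr` of `H¹(K_q, M)` with underlying groups `A = loc_q(𝓗^q(n))`,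
`𝓕_q`, `𝒯_q`; structure decompositions `θ₁ : 𝓗(n) ≃ Q^ε × M₁²`, `θ₂ : 𝓗(nq) ≃ Q^ε × M₂²` with the SAME `ε`
and `len Q = k`, `len Mᵢ = λᵢ`.  Conclusion: the hypothesis `hlen` of the Lagrangian transfer.
[cite: Howard2004HeegnerKolyvagin, Prop. 1.5.9 (proof) (arXiv:1202.6340 Prop. 2.5.9, p. 11 L3–9)] -/
theorem two_mul_add_length_eq_of_decompositions (𝓕 𝒯 : SelmerStructure ρ)
    (q : IsDedekindDomain.HeightOneSpectrum (𝓞 K)) (n : Finset (IsDedekindDomain.HeightOneSpectrum (𝓞 K)))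
    (hq : q ∉ n) (hρ : ρ.IsScalarLinear R) :
    letI := galoisCohomology.moduleH1 ρ hρ
    letI := galoisCohomology.moduleH1 (ρ.toLocal (Sum.inr q))
      (hρ.restrictField (Place.Completion (Sum.inr q)))
    ∀ (S₁ S₂ S𝓢 : Submodule R (galoisCohomology ρ 1))
      (SA SVf SVtr : Submodule R (galoisCohomology (ρ.toLocal (Sum.inr q)) 1)),
      S₁.toAddSubgroup = (𝓕.modify 𝒯 ∅ ∅ n).selmerGroup →
      S₂.toAddSubgroup = (𝓕.modify 𝒯 ∅ ∅ (insert q n)).selmerGroup →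
      S𝓢.toAddSubgroup = (𝓕.modify 𝒯 ∅ {q} n).selmerGroup →
      SA.toAddSubgroup = (𝓕.modify 𝒯 {q} ∅ n).selmerGroup.map
        (galoisCohomology.localization ρ (Sum.inr q) 1) →
      SVf.toAddSubgroup = 𝓕 (Sum.inr q) → SVtr.toAddSubgroup = 𝒯 (Sum.inr q) →
      ∀ {Q M₁ M₂ : Type} [AddCommGroup Q] [Module R Q] [AddCommGroup M₁] [Module R M₁]
        [AddCommGroup M₂] [Module R M₂] (ε k lam₁ lam₂ : ℕ),
        Nonempty (↥S₁ ≃ₗ[R] (Fin ε → Q) × (M₁ × M₁)) → Nonempty (↥S₂ ≃ₗ[R] (Fin ε → Q) × (M₂ × M₂)) →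
        Module.length R Q = k → Module.length R M₁ = lam₁ → Module.length R M₂ = lam₂ →
        2 * (lam₂ : ℕ∞) + Module.length R ↥(SA ⊓ SVf) =
          2 * (lam₁ : ℕ∞) + Module.length R ↥(SA ⊓ SVtr) := by
  letI := galoisCohomology.moduleH1 ρ hρ
  letI := galoisCohomology.moduleH1 (ρ.toLocal (Sum.inr q))
    (hρ.restrictField (Place.Completion (Sum.inr q)))
  intro S₁ S₂ S𝓢 SA SVf SVtr hS₁ hS₂ hS𝓢 hSA hSVf hSVtr Q M₁ M₂ _ _ _ _ _ _ ε k lam₁ lam₂ hθ₁ hθ₂ hQ hM₁ hM₂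
  obtain ⟨θ₁⟩ := hθ₁
  obtain ⟨θ₂⟩ := hθ₂
  -- the two `loc_q` length identities
  have h₁ := SelmerStructure.length_selmerGroup_eq_add_of_eq_off
    (SelmerStructure.modify_relaxed_apply_self 𝓕 𝒯 q n)
    (SelmerStructure.modify_level_eq_relaxed_of_ne 𝓕 𝒯 q n)
    (SelmerStructure.modify_strict_apply_self 𝓕 𝒯 q n)
    (SelmerStructure.modify_strict_eq_relaxed_of_ne 𝓕 𝒯 q n) hρ S₁ S𝓢 SA SVf hS₁ hS𝓢 hSA
    (by rw [hSVf, SelmerStructure.modify_level_apply_self 𝓕 𝒯 q n hq])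
  have h₂ := SelmerStructure.length_selmerGroup_eq_add_of_eq_off
    (SelmerStructure.modify_relaxed_apply_self 𝓕 𝒯 q n)
    (SelmerStructure.modify_insert_level_eq_relaxed_of_ne 𝓕 𝒯 q n)
    (SelmerStructure.modify_strict_apply_self 𝓕 𝒯 q n)
    (SelmerStructure.modify_strict_eq_relaxed_of_ne 𝓕 𝒯 q n) hρ S₂ S𝓢 SA SVtr hS₂ hS𝓢 hSA
    (by rw [hSVtr, SelmerStructure.modify_insert_level_apply_self 𝓕 𝒯 q n])
  have hd₁ := length_eq_of_linearEquiv_pi_prod_prod ε θ₁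
  have hd₂ := length_eq_of_linearEquiv_pi_prod_prod ε θ₂
  rw [hQ, hM₁] at hd₁
  rw [hQ, hM₂] at hd₂
  have hfin₁ : Module.length R ↥S₁ ≠ ⊤ := by
    rw [hd₁]
    have h : ((ε * k + 2 * lam₁ : ℕ) : ℕ∞) ≠ ⊤ := ENat.coe_ne_top _
    push_cast at h
    exact h
  have hfin₂ : Module.length R ↥S₂ ≠ ⊤ := by
    rw [hd₂]
    have h : ((ε * k + 2 * lam₂ : ℕ) : ℕ∞) ≠ ⊤ := ENat.coe_ne_top _
    push_cast at h
    exact h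
  exact two_mul_add_eq_two_mul_add_of_lengths h₁ h₂ hd₁ hd₂ hfin₁ hfin₂

/-! ## §4 Prop. 1.5.9 in the consumer's currency -/

open Pointwise in
/-- `r • N = 0 ↔ ∀ a ∈ N, r • a = 0` (pointwise scalar multiple of a submodule). [folklore] -/
private theorem pointwise_smul_eq_bot_iff' {V : Type*} [AddCommGroup V] [Module R V] (r : R)
    (N : Submodule R V) : r • N = ⊥ ↔ ∀ a ∈ N, r • a = 0 := by
  constructor
  · intro h a ha
    have hm : r • a ∈ r • N := Submodule.smul_mem_pointwise_smul a r N ha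
    rw [h] at hm
    exact (Submodule.mem_bot R).1 hm
  · intro h
    refine eq_bot_iff.2 fun x hx => ?_
    obtain ⟨b, hb, rfl⟩ := (Submodule.mem_smul_pointwise_iff_exists x r N).1 hx
    exact (Submodule.mem_bot R).2 (h b hb)

open scoped Classical in
open Pointwise in
/-- **Prop. 1.5.9 («`loc_q(Stub(n)) = 0 ⟹ loc_q(Stub(nq)) = 0`»), assembled.**  Same setting as
`two_mul_add_length_eq_of_decompositions`, plus an `R`-linear `f` agreeing with `loc_q` and the TRANSFER at `q`
as a hypothesis-function `htransfer` (the module-theoretic Lemma 1.5.7/1.5.8 output for `V = H¹(K_q, T)`,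
`A = loc_q 𝓗^q(n)`, `V_f = 𝓕_q`, `V_tr = 𝒯_q`: «`ϖ^λ` kills `A ∩ V_f` and the lengths match ⟹ `ϖ^{λ'}` kills
`A ∩ V_tr`»).  Conclusion: `ϖ^{λ(n)} • 𝓗(n) ≤ ker f → ϖ^{λ(nq)} • 𝓗(nq) ≤ ker f`.
[cite: Howard2004HeegnerKolyvagin, Prop. 1.5.9 (arXiv:1202.6340 Prop. 2.5.9, p. 10 L146 – p. 11 L13)] -/
theorem smul_le_ker_of_smul_le_ker_of_transfer (𝓕 𝒯 : SelmerStructure ρ)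
    (q : IsDedekindDomain.HeightOneSpectrum (𝓞 K)) (n : Finset (IsDedekindDomain.HeightOneSpectrum (𝓞 K)))
    (hq : q ∉ n) (hρ : ρ.IsScalarLinear R) (ϖ : R) :
    letI := galoisCohomology.moduleH1 ρ hρ
    letI := galoisCohomology.moduleH1 (ρ.toLocal (Sum.inr q))
      (hρ.restrictField (Place.Completion (Sum.inr q)))
    ∀ (f : galoisCohomology ρ 1 →ₗ[R] galoisCohomology (ρ.toLocal (Sum.inr q)) 1)
      (S₁ S₂ S𝓢 : Submodule R (galoisCohomology ρ 1))
      (SA SVf SVtr : Submodule R (galoisCohomology (ρ.toLocal (Sum.inr q)) 1)),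
      (∀ c, f c = galoisCohomology.localization ρ (Sum.inr q) 1 c) →
      S₁.toAddSubgroup = (𝓕.modify 𝒯 ∅ ∅ n).selmerGroup →
      S₂.toAddSubgroup = (𝓕.modify 𝒯 ∅ ∅ (insert q n)).selmerGroup →
      S𝓢.toAddSubgroup = (𝓕.modify 𝒯 ∅ {q} n).selmerGroup →
      SA.toAddSubgroup = (𝓕.modify 𝒯 {q} ∅ n).selmerGroup.map
        (galoisCohomology.localization ρ (Sum.inr q) 1) →
      SVf.toAddSubgroup = 𝓕 (Sum.inr q) → SVtr.toAddSubgroup = 𝒯 (Sum.inr q) →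
      ∀ {Q M₁ M₂ : Type} [AddCommGroup Q] [Module R Q] [AddCommGroup M₁] [Module R M₁]
        [AddCommGroup M₂] [Module R M₂] (ε k lam₁ lam₂ : ℕ),
        Nonempty (↥S₁ ≃ₗ[R] (Fin ε → Q) × (M₁ × M₁)) → Nonempty (↥S₂ ≃ₗ[R] (Fin ε → Q) × (M₂ × M₂)) →
        Module.length R Q = k → Module.length R M₁ = lam₁ → Module.length R M₂ = lam₂ →
        ((∀ a ∈ SA ⊓ SVf, ϖ ^ lam₁ • a = 0) →
          2 * (lam₂ : ℕ∞) + Module.length R ↥(SA ⊓ SVf) =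
            2 * (lam₁ : ℕ∞) + Module.length R ↥(SA ⊓ SVtr) →
          ∀ a ∈ SA ⊓ SVtr, ϖ ^ lam₂ • a = 0) →
        ϖ ^ lam₁ • S₁ ≤ LinearMap.ker f → ϖ ^ lam₂ • S₂ ≤ LinearMap.ker f := by
  letI := galoisCohomology.moduleH1 ρ hρ
  letI := galoisCohomology.moduleH1 (ρ.toLocal (Sum.inr q))
    (hρ.restrictField (Place.Completion (Sum.inr q)))
  intro f S₁ S₂ S𝓢 SA SVf SVtr hf hS₁ hS₂ hS𝓢 hSA hSVf hSVtr Q M₁ M₂ _ _ _ _ _ _ ε k lam₁ lam₂ hθ₁ hθ₂ hQ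
    hM₁ hM₂ htransfer hStub
  have hlen := two_mul_add_length_eq_of_decompositions 𝓕 𝒯 q n hq hρ S₁ S₂ S𝓢 SA SVf SVtr hS₁ hS₂ hS𝓢
    hSA hSVf hSVtr ε k lam₁ lam₂ hθ₁ hθ₂ hQ hM₁ hM₂
  -- `Stub(n) ≤ ker loc` ⟹ `ϖ^λ₁ • (A ∩ V_f) = 0`
  have hiff₁ := SelmerStructure.smul_selmerGroup_le_ker_iff_of_eq_off
    (SelmerStructure.modify_relaxed_apply_self 𝓕 𝒯 q n)
    (SelmerStructure.modify_level_eq_relaxed_of_ne 𝓕 𝒯 q n) hρ (ϖ ^ lam₁) f S₁ SA SVf hf hS₁ hSA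
    (by rw [hSVf, SelmerStructure.modify_level_apply_self 𝓕 𝒯 q n hq])
  have hiff₂ := SelmerStructure.smul_selmerGroup_le_ker_iff_of_eq_off
    (SelmerStructure.modify_relaxed_apply_self 𝓕 𝒯 q n)
    (SelmerStructure.modify_insert_level_eq_relaxed_of_ne 𝓕 𝒯 q n) hρ (ϖ ^ lam₂) f S₂ SA SVtr hf hS₂ hSA
    (by rw [hSVtr, SelmerStructure.modify_insert_level_apply_self 𝓕 𝒯 q n])
  rw [hiff₂, pointwise_smul_eq_bot_iff']
  rw [hiff₁, pointwise_smul_eq_bot_iff'] at hStub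
  exact htransfer hStub hlen

end Selmer

end Literature.NumberTheory.GaloisCohomology.Howard2004

end
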